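import Summits.KontsevichZagierPeriods.KontsevichZagierPeriods.Theorems.ValuedFieldSpecialisationParametricLiftingStrength
import Summits.KontsevichZagierPeriods.KontsevichZagierPeriods.Theorems.ValuedFieldSpecialisationCTConstructionComposition
import Summits.KontsevichZagierPeriods.KontsevichZagierPeriods.Theorems.ValuedFieldSpecialisationCTConstructionCoreEntryPure

/-!
# Route ValuedFieldSpecialisation — crux `CTConstruction` (stmt-KontsevichZagierPeriods-3495): the reduction of line
# `registered` is LOSSLESS — modulo `ClassLevelExpansion` the crux IS the pure special-fibre rigidity

Helper (`--supports stmt-KontsevichZagierPeriods-3495`) for line `registered` (lead cycle 5). After reshape r4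
(`coreReduction_of_pure`, file `…CTConstructionCoreEntryPure`) the registered skeleton of the crux has exactly two
sorried stubs: `stub_classLevelExpansion` (verbatim the route item `ClassLevelExpansion`, stmt-3496) and the kernel
stub `stub_pureSpecialFibreRigidity` (PURE): *if `(G, y)` lies in the subgroup of `FormalRep × FormalRep` generated by
the dominated pairs `([S], [r₀])` and `G ∈ KZ.fibredRelations`, then `y ∈ KZ.relations`.* The sibling crux
`ParametricLifting` (stmt-3498) carries the same statement in `Fin`-indexed form SF (`stub_specialFibreRigidity`
there; `…ParametricLiftingStrength`: summit ⇔ PL ∧ SF, `CTConstruction` ⇒ SF). This file pins the logical position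
of PURE for THIS crux, with no new definition:

* `exists_sum_of_mem_closure_dominatedPairs` / `sum_mem_closure_dominatedPairs` — membership in the closure of the
  dominated pairs is the literal `Fin k`-indexed shape `(Σ mᵢ [Sᵢ], Σ mᵢ [r₀ᵢ])` (`ℤ`-span = subgroup closure).
* `stub_pure_iff_specialFibre` — **PURE ⇔ SF**: the kernel stubs of the two cruxes of the route are one statement.
* `stub_pure_of_ctConstruction` — **`CTConstruction` ⇒ PURE** (through SF): the kernel stub is NECESSARY for the crux,
  so isolating it loses nothing.
* `stub_ctConstruction_of_classLevelExpansion_of_pure` — **`ClassLevelExpansion` ⇒ PURE ⇒ `CTConstruction`**, the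
  skeleton's composition as a tree theorem (`ctConstruction_of_normalForms_to KZ.relations` with rigidity supplied by
  `coreReduction_of_pure`; the value hypothesis by `eval_eq_zero_of_add_mem_fibredRelations`).
* `stub_ctConstruction_iff_pure` — **under `ClassLevelExpansion`, `CTConstruction` ⇔ PURE**: given the route's
  existence item, the thesis-bearing crux is EXACTLY the specialisation of fibred relations among dominated families.
* `pure_of_kontsevichZagierPeriods` — summit ⇒ PURE (so PURE is not refutable short of refuting the summit).

Sources: M. Kontsevich, D. Zagier, *Periods* (2001), §1.2 (moves, Conjecture 1); this route's vocabulary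
(`KZFibredRelations.lean`, `KZDominatedFamily.lean`). Deliberately NOT here: any claim toward PURE itself.
-/

noncomputable section

namespace Summit.KontsevichZagierPeriods.ValuedFieldSpecialisation

open MeasureTheory Set Filter
open scoped Topology
open Literature.NumberTheory.Transcendental
open Summit.KontsevichZagierPeriods.KontsevichZagierPeriods.Theses.ValuedFieldSpecialisation
  (CTConstruction ClassLevelExpansion ParametricLifting)

/-- Membership in the subgroup generated by the dominated pairs `([S], [r₀])` is the literal `Fin k`-indexed shape
`(G, y) = (Σ mᵢ [Sᵢ], Σ mᵢ [r₀ᵢ])` with every `Sᵢ` dominated near `s = 0⁺` with special fibre `r₀ᵢ`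
(`ℤ`-span = subgroup closure, `Submodule.mem_span_set'`). [folklore] -/
theorem exists_sum_of_mem_closure_dominatedPairs (G y : KZ.FormalRep)
    (h : (G, y) ∈ AddSubgroup.closure {v : Literature.NumberTheory.Transcendental.KZ.FormalRep × Literature.NumberTheory.Transcendental.KZ.FormalRep | ∃ (n : ℕ) (S : Literature.NumberTheory.Transcendental.KZ.IntegralRep (n + 1)) (r₀ g : Literature.NumberTheory.Transcendental.KZ.IntegralRep n), Literature.NumberTheory.Transcendental.KZ.IsDominatedFamily S r₀ g ∧ v = (Literature.NumberTheory.Transcendental.KZ.of S, Literature.NumberTheory.Transcendental.KZ.of r₀)}) :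
    ∃ (k : ℕ) (d : Fin k → ℕ) (m : Fin k → ℤ) (S : (i : Fin k) → KZ.IntegralRep (d i + 1))
      (r₀ g : (i : Fin k) → KZ.IntegralRep (d i)), (∀ i, KZ.IsDominatedFamily (S i) (r₀ i) (g i)) ∧
      G = ∑ i, m i • KZ.of (S i) ∧ y = ∑ i, m i • KZ.of (r₀ i) := by
  classical
  rw [← Submodule.span_int_eq_addSubgroupClosure, Submodule.mem_toAddSubgroup] at h
  obtain ⟨k, m, v, hv⟩ := Submodule.mem_span_set'.mp h
  choose d S r₀ g hdom hvi using fun i => (v i).2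
  refine ⟨k, d, m, S, r₀, g, hdom, ?_, ?_⟩
  · have h1 := congrArg Prod.fst hv
    simp only [Prod.fst_sum, Prod.smul_fst] at h1
    rw [← h1]
    exact Finset.sum_congr rfl fun i _ => by rw [hvi i]
  · have h2 := congrArg Prod.snd hv
    simp only [Prod.snd_sum, Prod.smul_snd] at h2
    rw [← h2]
    exact Finset.sum_congr rfl fun i _ => by rw [hvi i]

/-- Conversely, a `Fin k`-indexed dominated net paired with its special-fibre combination lies in the subgroup
generated by the dominated pairs. [folklore] -/
theorem sum_mem_closure_dominatedPairs {k : ℕ} {d : Fin k → ℕ} (m : Fin k → ℤ)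
    (S : (i : Fin k) → KZ.IntegralRep (d i + 1)) (r₀ g : (i : Fin k) → KZ.IntegralRep (d i))
    (hdom : ∀ i, KZ.IsDominatedFamily (S i) (r₀ i) (g i)) :
    ((∑ i, m i • KZ.of (S i)), (∑ i, m i • KZ.of (r₀ i))) ∈ AddSubgroup.closure {v : Literature.NumberTheory.Transcendental.KZ.FormalRep × Literature.NumberTheory.Transcendental.KZ.FormalRep | ∃ (n : ℕ) (S : Literature.NumberTheory.Transcendental.KZ.IntegralRep (n + 1)) (r₀ g : Literature.NumberTheory.Transcendental.KZ.IntegralRep n), Literature.NumberTheory.Transcendental.KZ.IsDominatedFamily S r₀ g ∧ v = (Literature.NumberTheory.Transcendental.KZ.of S, Literature.NumberTheory.Transcendental.KZ.of r₀)} := by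
  have hEq : ((∑ i, m i • KZ.of (S i)), (∑ i, m i • KZ.of (r₀ i))) =
      ∑ i, m i • (KZ.of (S i), KZ.of (r₀ i)) := by
    ext <;> simp [Prod.fst_sum, Prod.snd_sum]
  have hmem : ∀ i, (KZ.of (S i), KZ.of (r₀ i)) ∈ {v : Literature.NumberTheory.Transcendental.KZ.FormalRep × Literature.NumberTheory.Transcendental.KZ.FormalRep | ∃ (n : ℕ) (S : Literature.NumberTheory.Transcendental.KZ.IntegralRep (n + 1)) (r₀ g : Literature.NumberTheory.Transcendental.KZ.IntegralRep n), Literature.NumberTheory.Transcendental.KZ.IsDominatedFamily S r₀ g ∧ v = (Literature.NumberTheory.Transcendental.KZ.of S, Literature.NumberTheory.Transcendental.KZ.of r₀)} :=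
    fun i => ⟨d i, S i, r₀ i, g i, hdom i, rfl⟩
  rw [hEq]
  exact sum_mem fun i _ => AddSubgroup.zsmul_mem _ (AddSubgroup.subset_closure (hmem i)) _

/-- **PURE ⇔ SF** (registered sub-goal `stub_pure_iff_specialFibre` of crux stmt-3495): the kernel stub
`stub_pureSpecialFibreRigidity` of crux `CTConstruction` (closure-of-dominated-pairs form) and the kernel stub
`stub_specialFibreRigidity` of crux `ParametricLifting` (stmt-3498, `Fin`-indexed form) are the same statement:
*fibred relations among dominated families specialise to relations among their special fibres.* [folklore] -/
theorem stub_pure_iff_specialFibre : (∀ (G y : Literature.NumberTheory.Transcendental.KZ.FormalRep), (G, y) ∈ AddSubgroup.closure {v : Literature.NumberTheory.Transcendental.KZ.FormalRep × Literature.NumberTheory.Transcendental.KZ.FormalRep | ∃ (n : ℕ) (S : Literature.NumberTheory.Transcendental.KZ.IntegralRep (n + 1)) (r₀ g : Literature.NumberTheory.Transcendental.KZ.IntegralRep n), Literature.NumberTheory.Transcendental.KZ.IsDominatedFamily S r₀ g ∧ v = (Literature.NumberTheory.Transcendental.KZ.of S, Literature.NumberTheory.Transcendental.KZ.of r₀)}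 → G ∈ Literature.NumberTheory.Transcendental.KZ.fibredRelations → y ∈ Literature.NumberTheory.Transcendental.KZ.relations) ↔ (∀ (k : ℕ) (d : Fin k → ℕ) (m : Fin k → ℤ) (R : (i : Fin k) → Literature.NumberTheory.Transcendental.KZ.IntegralRep (d i + 1)) (r₀ g : (i : Fin k) → Literature.NumberTheory.Transcendental.KZ.IntegralRep (d i)), (∀ i, Literature.NumberTheory.Transcendental.KZ.IsDominatedFamily (R i) (r₀ i) (g i)) → (∑ i, m i • Literature.NumberTheory.Transcendental.KZ.of (R i)) ∈ Literature.NumberTheory.Transcendental.KZ.fibredRelations → (∑ i, m i • Literature.NumberTheory.Transcendental.KZ.of (r₀ i)) ∈ Literature.NumberTheory.Transcendental.KZ.relations) := by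
  constructor
  · intro hP k d m R r₀ g hdom hG
    exact hP _ _ (sum_mem_closure_dominatedPairs m R r₀ g hdom) hG
  · intro hSF G y hGy hG
    obtain ⟨k, d, m, S, r₀, g, hdom, rfl, rfl⟩ := exists_sum_of_mem_closure_dominatedPairs G y hGy
    exact hSF k d m S r₀ g hdom hG

/-- **`CTConstruction` ⇒ PURE** (registered sub-goal `stub_pure_of_ctConstruction` of crux stmt-3495): the constant-term
functor sends the fibred subgroup into `KZ.relations` (CT2) and every dominated family to its special fibre (CT3)
(`specialFibre_of_ctConstruction`), and SF is PURE (`stub_pure_iff_specialFibre`). So the kernel stub of line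
`registered` is a NECESSARY condition of the crux: isolating it loses nothing. [folklore] -/
theorem stub_pure_of_ctConstruction : Summit.KontsevichZagierPeriods.KontsevichZagierPeriods.Theses.ValuedFieldSpecialisation.CTConstruction → ∀ (G y : Literature.NumberTheory.Transcendental.KZ.FormalRep), (G, y) ∈ AddSubgroup.closure {v : Literature.NumberTheory.Transcendental.KZ.FormalRep × Literature.NumberTheory.Transcendental.KZ.FormalRep | ∃ (n : ℕ) (S : Literature.NumberTheory.Transcendental.KZ.IntegralRep (n + 1)) (r₀ g : Literature.NumberTheory.Transcendental.KZ.IntegralRep n), Literature.NumberTheory.Transcendental.KZ.IsDominatedFamily S r₀ g ∧ v = (Literature.NumberTheory.Transcendental.KZ.of S, Literature.NumberTheory.Transcendental.KZ.of r₀)} → G ∈ Literature.NumberTheory.Transcendental.KZ.fibredRelations → y ∈ Literature.NumberTheory.Transcendental.KZ.relations :=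
  fun hCT => stub_pure_iff_specialFibre.mpr (specialFibre_of_ctConstruction hCT)

/-- **Summit ⇒ PURE** (through SF, `specialFibre_of_kontsevichZagierPeriods`): the kernel stub cannot be refuted
without refuting the Kontsevich–Zagier conjecture. [Kontsevich–Zagier 2001, §1.2 Conjecture 1] [folklore] -/
theorem pure_of_kontsevichZagierPeriods (hKZ : KontsevichZagierPeriods) :
    ∀ (G y : Literature.NumberTheory.Transcendental.KZ.FormalRep), (G, y) ∈ AddSubgroup.closure {v : Literature.NumberTheory.Transcendental.KZ.FormalRep × Literature.NumberTheory.Transcendental.KZ.FormalRep | ∃ (n : ℕ) (S : Literature.NumberTheory.Transcendental.KZ.IntegralRep (n + 1)) (r₀ g : Literature.NumberTheory.Transcendental.KZ.IntegralRep n), Literature.NumberTheory.Transcendental.KZ.IsDominatedFamily S r₀ g ∧ v = (Literature.NumberTheory.Transcendental.KZ.of S, Literature.NumberTheory.Transcendental.KZ.of r₀)} → G ∈ Literature.NumberTheory.Transcendental.KZ.fibredRelations → y ∈ Literature.NumberTheory.Transcendental.KZ.relations :=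
  stub_pure_iff_specialFibre.mpr (specialFibre_of_kontsevichZagierPeriods hKZ)

/-- **`ClassLevelExpansion` ⇒ PURE ⇒ `CTConstruction`** (registered sub-goal `stub_ctConstruction_of_classLevelExpansion_of_pure`
of crux stmt-3495): the composition of line `registered` as a tree theorem. `CT := FreeAbelianGroup.lift` of
"generator ↦ special-fibre class of a chosen fibred normal form" (`ctConstruction_of_normalForms_to KZ.relations`);
normal forms from `ClassLevelExpansion`; rigidity of special fibres from PURE ALONE (`coreReduction_of_pure`, reshape
r4 — blow-up elimination of the elementary divergent part), its value hypothesis being the landed value shadow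
`eval_eq_zero_of_add_mem_fibredRelations`; values of constant terms from `constantTermOfNormalForm`. [folklore] -/
theorem stub_ctConstruction_of_classLevelExpansion_of_pure : Summit.KontsevichZagierPeriods.KontsevichZagierPeriods.Theses.ValuedFieldSpecialisation.ClassLevelExpansion → (∀ (G y : Literature.NumberTheory.Transcendental.KZ.FormalRep), (G, y) ∈ AddSubgroup.closure {v : Literature.NumberTheory.Transcendental.KZ.FormalRep × Literature.NumberTheory.Transcendental.KZ.FormalRep | ∃ (n : ℕ) (S : Literature.NumberTheory.Transcendental.KZ.IntegralRep (n + 1)) (r₀ g : Literature.NumberTheory.Transcendental.KZ.IntegralRep n), Literature.NumberTheory.Transcendental.KZ.IsDominatedFamily S r₀ g ∧ v = (Literature.NumberTheory.Transcendental.KZ.of S, Literature.NumberTheory.Transcendental.KZ.of r₀)} → G ∈ Literature.NumberTheory.Transcendental.KZ.fibredRelations → y ∈ Literature.NumberTheory.Transcendental.KZ.relations) → Summit.KontsevichZagierPeriods.KontsevichZagierPeriods.Theses.ValuedFieldSpecialisation.CTConstruction := by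
  intro h₁ hPURE
  refine ctConstruction_of_normalForms_to Literature.NumberTheory.Transcendental.KZ.relations h₁ ?_
    constantTermOfNormalForm
  intro D hD G y hGy hF
  exact coreReduction_of_pure hPURE D hD G y hGy hF (eval_eq_zero_of_add_mem_fibredRelations D hD G y hGy hF)

/-- **Under `ClassLevelExpansion`, `CTConstruction` ⇔ PURE** (registered sub-goal `stub_ctConstruction_iff_pure` of crux
stmt-3495): given the route's existence item (stmt-3496), the thesis-bearing crux of route ValuedFieldSpecialisation is
EXACTLY the specialisation of fibred relations among dominated families (`stub_pure_of_ctConstruction`,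
`stub_ctConstruction_of_classLevelExpansion_of_pure`). [folklore] -/
theorem stub_ctConstruction_iff_pure : Summit.KontsevichZagierPeriods.KontsevichZagierPeriods.Theses.ValuedFieldSpecialisation.ClassLevelExpansion → (Summit.KontsevichZagierPeriods.KontsevichZagierPeriods.Theses.ValuedFieldSpecialisation.CTConstruction ↔ ∀ (G y : Literature.NumberTheory.Transcendental.KZ.FormalRep), (G, y) ∈ AddSubgroup.closure {v : Literature.NumberTheory.Transcendental.KZ.FormalRep × Literature.NumberTheory.Transcendental.KZ.FormalRep | ∃ (n : ℕ) (S : Literature.NumberTheory.Transcendental.KZ.IntegralRep (n + 1)) (r₀ g : Literature.NumberTheory.Transcendental.KZ.IntegralRep n), Literature.NumberTheory.Transcendental.KZ.IsDominatedFamily S r₀ g ∧ v = (Literature.NumberTheory.Transcendental.KZ.of S, Literature.NumberTheory.Transcendental.KZ.of r₀)} → G ∈ Literature.NumberTheory.Transcendental.KZ.fibredRelations → y ∈ Literature.NumberTheory.Transcendental.KZ.relations) :=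
  fun h₁ => ⟨stub_pure_of_ctConstruction, stub_ctConstruction_of_classLevelExpansion_of_pure h₁⟩

/-- **Summit ⇔ `ParametricLifting` ∧ PURE** — the closure-form twin of
`kontsevichZagierPeriods_iff_parametricLifting_and_specialFibre`: the route's two cruxes meet in ONE kernel
statement, and together with the open core `ParametricLifting` that kernel statement is the summit. [folklore] -/
theorem kontsevichZagierPeriods_iff_parametricLifting_and_pure :
    KontsevichZagierPeriods ↔ Summit.KontsevichZagierPeriods.KontsevichZagierPeriods.Theses.ValuedFieldSpecialisation.ParametricLifting ∧ ∀ (G y : Literature.NumberTheory.Transcendental.KZ.FormalRep), (G, y) ∈ AddSubgroup.closure {v : Literature.NumberTheory.Transcendental.KZ.FormalRep × Literature.NumberTheory.Transcendental.KZ.FormalRep | ∃ (n : ℕ) (S : Literature.NumberTheory.Transcendental.KZ.IntegralRep (n + 1)) (r₀ g : Literature.NumberTheory.Transcendental.KZ.IntegralRep n), Literature.NumberTheory.Transcendental.KZ.IsDominatedFamily S r₀ g ∧ v = (Literature.NumberTheory.Transcendental.KZ.of S, Literature.NumberTheory.Transcendental.KZ.of r₀)} → G ∈ Literature.NumberTheory.Transcendental.KZ.fibredRelations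 → y ∈ Literature.NumberTheory.Transcendental.KZ.relations := by
  rw [kontsevichZagierPeriods_iff_parametricLifting_and_specialFibre, stub_pure_iff_specialFibre]

end Summit.KontsevichZagierPeriods.ValuedFieldSpecialisation
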